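import Literature.MathematicalPhysics.QuantumFieldTheory.Balaban1983to89.B8DentedCubeMemberTorusLandau
import Literature.MathematicalPhysics.QuantumFieldTheory.Balaban1983to89.B8CubeMemberTorusSizeLines

/-!
# `Balaban1983to89.B8DentedCubeMemberTorusSizeLines` — TRANSPLANT STEP T4 (part 2 of 3) ON THE DENTED CUBE MEMBER of [Balaban1985Variational] (148)–(150): THE TWO SIZE
# LINES OF THE TORUS READING [Balaban1984PropagatorsII] (2.136) — `|∂*∂A| ≤ nJ·(…)⁻³` with `nJ := (16(d+1)+1)N` and `|QA| ≤ nB·(…)⁻¹` with `nB := N` — for the translated lift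
# `A = g∘φ(· − t)` of a field satisfying the hypotheses (i)–(iii) of [Balaban1985RegularSpaces] (1.59) on the DENTED tower `CubeB8D.sq` with averaging class `CubeB8D.lamBP`

statement-level skeleton of published theorems with citation tags; proofs where landed; nothing here is a claim about the
Yang–Mills mass gap

`[Balaban1985RegularSpaces]` ("B8" = [6], CMP **99** (1985) 75–102) (1.59) p. 86, (1.55) p. 86, (1.131) p. 99, (1.5) p. 77; `[Balaban1984PropagatorsII]` ("B6", CMP **96**
(1984) 223–250) (2.136) p. 247, (2.3) p. 224, (2.20) p. 226, (2.16) p. 225; `[Balaban1985Variational]` ("[15]", CMP **102** (1985) 277–309) (148)–(150) p. 301, (152) p. 301;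
`[Balaban1985Averaging]` ([B7], CMP **98** (1985) 17–51) Prop. 4 p. 38.  PDF held: `paper:balaban1985-cmp99-regular-spaces-gauge-fixing`, `paper:balaban1985-cmp102-variational-background`.

CITATION HEADER (lean-in-tree rule).  Cell `pub-ymgap` (YM Track A, HUMAN RULING D-0062), DAG node N05 = [B8], seat `pub-ymgap-dag-n05-e` (g32; FAN-OUT §N05 row s3b,
Proposition-6 lane; piece (d2-c) of the (β) road: dag-n05-c PRICE I.41357, STANDING GO I.42366; this seat INTENT I.43297).  WHY THIS FILE.  dag-n05-c's
`B8CubeMemberTorusSizeLines` (T4 part 2) supplies the two size lines `abs_dcsE_dcE_liftB_le` ∕ `abs_QE_liftB_le` that feed lit-balaban's level-0 torus reading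
`B8Prop3MultiLevelTorusP26L0.prop3_multiLevelTorus_V1_P26_vector` at the PURE member; its generic lemmas (`exists_bound_of_near`, `deepSupp_translate`, `box_of_near_cube_zero`,
`globalBand_weights`, `DV_liftB_translate`, `laplace_liftB_translate`) are IMPORTED here by name.  THIS FILE re-reads the member-specific ones on NODE 00's DENTED datum
`c : CubeB8D` (tower `c.sq`, class `c.lamBP` of p659892) at `D = cubeTDomainsDented …` (p659647) through the dented dictionaries (this seat, files 1–2): the `J` size line keys
on `len_blkV1_member` with `levD`, the `B` size line on `lamBond_iff ∕ lamBond_zero_iff` ↔ `c.lamBP` ∕ «both ends off `t + Ω′₁`», and the level-`0` local bound on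
`mem_lamBP_zero` (a bond touching `□₀` with both ends off `Ω′₁` is a level-`0` class bond — for `k = 1` the bonds over the dent are such).

WHAT THIS FILE PROVES (kernel-checked; `L = ℓ + 1 ≥ 2`; dented datum `c : Node00.CubeB8D (d+1) (ℓ+1) K Ω`, top truncation; host as in files 1–2).
* §1 field side: `exists_near_of_ne_zero` (support within one of `□₀` from the dented support hypothesis), `mem_lamBP_zero`, `eta_norm_le_of_touches`, ★ `eta_norm_le_of_near_not_mem`
  (the local bound off `□₀`), `le_levD_translate_add_one` (the level slack of a side bond: `j ≤ levD(y + t) + 1` for `y` within one of `Ω′_j`).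
* §2 torus side: ★★ `abs_dcsE_dcE_liftB_le` (the `J` line, `nJ = (16(d+1)+1)N`), ★★ `abs_QE_liftB_le` (the `B` line, `nB = N`) at `D = cubeTDomainsDented …`.

HONEST SCOPE ∕ NOT CLAIMED.  Dictionary lemmas for the consumer `B8Ineq159FlatDentedCubeMemberTransplant.ineq159FlatDentedCubeMemberPrinted_holds` (file 4); no estimate beyond
the local double-difference bound of T4 (`norm_Jcur_one_le_of_near`, USED by name).  Count-neutral; N05 ∕ N07 NOT discharged; one finite `T⁴` programme at fixed `ε`, Bałaban as
printed; nothing continuum ∕ ℝ⁴ ∕ OS ∕ mass-gap ∕ Clay.  No `sorry`, no `def`, no `instance`, no `notation`.  Unit `pub-ymgap-dag-n05-e` (g32), 2026-08-28.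

RELATED IN THE TREE, NOT DUPLICATED (`rg -l 'DentedCubeMemberTorusSizeLines' Balaban1983to89` = 0, 2026-08-28T22:00Z): T4 `B8CubeMemberTorusSizeLines` (dag-n05-c g12; the PURE
member — generic lemmas USED by name, member-specific ones the model), `B8FlatOperatorsTranslateLocal` (dag-n05-c; USED), `B8DentedCubeMemberTorusClasses ∕ …Landau` (this seat
g32; USED), `Node00.CubeB8D` (p655171), `CubeB8D.lamBP` (p659892).
-/
noncomputable section

namespace Literature.MathematicalPhysics.QuantumFieldTheory.Balaban1983to89.B8DentedCubeMemberTorusSizeLines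

open B7Prop1Explicit (e e_apply)
open B7Prop1Local (InBox)
open B8Ineq132 (covDerivFwd covDeriv BondTouches PlaqTouches Under)
open B8Eq146AExpansion (plaqCovDeriv iEta)
open B8Eq155JBound (Jcur)
open B8Eq138LandauZd (covLap covDivB)
open B8Eq140Level (SideTouches IsSide)
open B8FlatOperatorsTranslateLocal (covDerivFwd_one_translate Jcur_one_translate covLap_one_translate norm_Jcur_one_le_of_near near_of_sideTouches)
open B4Reflection242 (boxDom mem_boxDom blk)
open B6MultiLevelBoxOperator (N0 bigSide)
open B6GlobalChartV1 (PV toBox toBox_apply)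
open B6GlobalChartV1L0 (domT blkV1)
open B6SectAOperatorsV1 (dcE dcsE dsE QE RE QE_apply)
open BalabanImbrieJaffe1984to88.BIJ85AxialPropagator411 (BondSpace)
open B6GradLegKLevelV1 (DV)
open B6CubeWindowV1 (GlobalBand)
open LatticeFieldCalculus (laplace bondAvgIter)
open B8Eq131Cubes (cube sqLo sqHi inLo inHi)
open B8Eq131CubesAdmissible (cubeFam cubeFam_false_of_le cubeFam_false_zero smul_mem_cube_iff smul_mem_cube_succ_iff)
open B8CubeMemberBoxDomains (shift boxP collar_gap)
open B8CubeMemberTorusDomainsDented (cubeTDomainsDented levD levD_le le_levD_iff)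
open B8CubeMemberTorusChart (toTorus labels labels_toTorus DeepSupp liftB liftB_apply DV_liftB laplace_liftB dcsE_dcE_liftB)
open B8CubeMemberTorusAverages (labelsJ labelsJ_zero norm_bondAvgIter_liftB_le linCovIter_one_translate)
open B8CubeMemberTorusClasses (shiftJ shift_eq_smul_shiftJ labelsJ_shift_of_lt)
open B8CubeMemberTorusSizeLines (exists_bound_of_near deepSupp_translate box_of_near_cube_zero)
open B8DentedCubeMemberTorusClasses (lamBond_iff labelsJ_tgt_of_lamBond lamBond_zero_iff len_blkV1_member le_levD_labels_iff levD_labels_le)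
open B8DentedCubeMemberTorusClasses (mem_sq_one_iff)
open B8Eq138LandauZd (IsLandau138)
open B7Prop4GeneralLevels (linCovIter linCovIter_zero)
open Node00 (CubeB8D)

variable {d : ℕ}

/-! ## §1 Field-side lemmas on `ℤ^{d+1}`: support, print's level-0 class on the dented tower, the local bound off `□₀`, the level slack -/

section FieldSide

variable {ℓ K : ℕ} {Ω : ℕ → Set (Fin (d + 1) → ℤ)} (c : CubeB8D (d + 1) (ℓ + 1) K Ω)

/-- **THE SUPPORT OF THE FIELD IS WITHIN SUP-DISTANCE ONE OF `□₀`**: a bond off every `p ∩ Ω′_j ≠ ∅` plaquette carries `φ = 0` (hypothesis on the dented tower), and a side of a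
plaquette touching `Ω′_j ⊂ □_j ⊂ □₀` is within one of `□₀`. [cite: Balaban1985RegularSpaces, p.77 (convention before (1.5)), (1.131) p.99; Balaban1985Variational, (148)–(150) p.301] -/
theorem exists_near_of_ne_zero {φ : (Fin (d + 1) → ℤ) → Fin (d + 1) → ℂ}
    (hsupp : ∀ y τ, (∀ j ≤ c.k, ¬ SideTouches (c.sq j) y τ) → φ y τ = 0)
    {z : Fin (d + 1) → ℤ} {τ : Fin (d + 1)} (hz : φ z τ ≠ 0) :
    ∃ s ∈ cube (ℓ + 1) c.a c.M c.ρ c.k 0, ∀ i, |z i - s i| ≤ 1 := by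
  by_contra hno
  push Not at hno
  apply hz
  refine hsupp z τ fun j hj hs => ?_
  obtain ⟨⟨s, hs', hclose⟩, -⟩ := near_of_sideTouches hs
  obtain ⟨i, hi⟩ := hno s (B8Eq131Cubes.cube_anti (Nat.zero_le j) hj (c.sq_subset_cube hj hs'))
  exact absurd (hclose i) (not_le.mpr hi)

/-- `y ∈ □₀ ↔ y ∈ [sqLo 0, sqHi 0]` (plumbing). [cite: Balaban1985RegularSpaces, (1.131) p.99, dictionary] -/
private theorem mem_cube_zero_iff (y : Fin (d + 1) → ℤ) :
    y ∈ cube (ℓ + 1) c.a c.M c.ρ c.k 0 ↔ InBox (sqLo (ℓ + 1) c.a c.ρ c.k 0) (sqHi (ℓ + 1) c.a c.M c.ρ c.k 0) y := by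
  have h := smul_mem_cube_iff (Nat.succ_pos ℓ) c.a c.M c.ρ c.k 0 y
  rwa [pow_zero, one_smul] at h

/-- **A BOND TOUCHING `□₀` WITH BOTH ENDS OFF `Ω′₁` BELONGS TO PRINT's LEVEL-0 CLASS `c.lamBP 0` OF THE DENTED TOWER** (for `k ≥ 2`, «both ends off `□₁`»; for `k = 1` the bonds
over the dent `□₁ ∖ Ω₁` are level-`0` class members). [cite: Balaban1985RegularSpaces, (1.131) p.99 («Λ′₀ = T ∖ □₁»); Balaban1985Variational, (148)–(150) p.301; Balaban1984PropagatorsII, (2.3) p.224] -/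
theorem mem_lamBP_zero {y : Fin (d + 1) → ℤ} {τ : Fin (d + 1)}
    (hbt : BondTouches (cube (ℓ + 1) c.a c.M c.ρ c.k 0) y τ) (h1 : y ∉ c.sq 1) (h2 : y + e τ ∉ c.sq 1) : (y, τ) ∈ c.lamBP 0 := by
  have hk := c.one_le_k
  rw [B8Ineq159FlatDentedCubeMemberPrinted.mem_lamBP_iff]
  refine ⟨Nat.zero_le _, ?_, fun _ => ⟨fun h => h1 ((mem_sq_one_iff c y).2 h), fun h => h2 ((mem_sq_one_iff c _).2 h)⟩⟩
  rcases hbt with h | h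
  · exact Or.inl ⟨(mem_cube_zero_iff c y).1 h, fun h0 => by omega⟩
  · exact Or.inr ⟨(mem_cube_zero_iff c _).1 h, fun h0 => by omega⟩

/-- `η‖φ(b)‖ ≤ N` on a bond touching `□₀` with both ends off `Ω′₁`, by hypothesis (ii) at level `0` (`Q₀ = 1`).
[cite: Balaban1985RegularSpaces, (1.59) p.86 (hypothesis «|Q_j(iηφ)| ≤ …» at j = 0), (1.131) p.99; Balaban1985Variational, (148)–(150) p.301] -/
theorem eta_norm_le_of_touches {η : ℝ} (hη : 0 ≤ η) {φ : (Fin (d + 1) → ℤ) → Fin (d + 1) → ℂ} {N : ℝ}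
    (hQ0 : ∀ b ∈ c.lamBP 0, ‖linCovIter (ℓ + 1) (1 : (Fin (d + 1) → ℤ) → Fin (d + 1) → ℂˣ) (iEta η φ) 0 b.1 b.2‖ ≤ N)
    {y : Fin (d + 1) → ℤ} {τ : Fin (d + 1)} (hbt : BondTouches (cube (ℓ + 1) c.a c.M c.ρ c.k 0) y τ) (h1 : y ∉ c.sq 1)
    (h2 : y + e τ ∉ c.sq 1) : η * ‖φ y τ‖ ≤ N := by
  have h := hQ0 (y, τ) (mem_lamBP_zero c hbt h1 h2)
  rw [linCovIter_zero] at h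
  have hn : ‖iEta η φ y τ‖ = η * ‖φ y τ‖ := by
    simp only [iEta, norm_smul, norm_mul, Complex.norm_I, one_mul, Complex.norm_real, Real.norm_of_nonneg hη]
  rw [← hn]; exact h

/-- ★ **THE LOCAL BOUND OFF `□₀`**: if `x ∉ □₀`, every bond `⟨y′, τ′⟩` with `|y′ − x|_∞ ≤ 1` has `η‖φ(y′, τ′)‖ ≤ N` — both its ends are off `□₁ ⊇ Ω′₁` (collar `ρ ≥ 3`), so
either it touches `□₀ = Ω′₀` and hypothesis (ii) at level `0` applies, or hypothesis (iii) does. [cite: Balaban1985RegularSpaces, (1.59) p.86, (1.131) p.99, (1.5) p.77; Balaban1985Variational, (150) p.301] -/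
theorem eta_norm_le_of_near_not_mem {η : ℝ} (hη : 0 ≤ η) (hρ3 : 3 ≤ c.ρ) {φ : (Fin (d + 1) → ℤ) → Fin (d + 1) → ℂ} {N : ℝ}
    (hQ0 : ∀ b ∈ c.lamBP 0, ‖linCovIter (ℓ + 1) (1 : (Fin (d + 1) → ℤ) → Fin (d + 1) → ℂˣ) (iEta η φ) 0 b.1 b.2‖ ≤ N)
    (hout : ∀ y τ, ¬ BondTouches (c.sq 0) y τ → η * ‖φ y τ‖ ≤ N)
    {x : Fin (d + 1) → ℤ} (hx0 : x ∉ cube (ℓ + 1) c.a c.M c.ρ c.k 0) {y' : Fin (d + 1) → ℤ} (hy' : ∀ i, |y' i - x i| ≤ 1) (τ' : Fin (d + 1)) :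
    η * ‖φ y' τ'‖ ≤ N := by
  have hk := c.one_le_k
  -- points within sup-distance two of `x ∉ □₀` are off `□₁ ⊇ Ω′₁`
  have hfar : ∀ z : Fin (d + 1) → ℤ, (∀ i, |z i - x i| ≤ 2) → z ∉ c.sq 1 := by
    intro z hz hz1
    obtain ⟨i, hi⟩ := collar_gap c.a hk hx0 (c.sq_subset_cube hk hz1)
    rw [pow_zero, mul_one, abs_sub_comm] at hi
    have h3 : (3 : ℤ) ≤ (c.ρ : ℤ) := by exact_mod_cast hρ3
    linarith [hz i]
  have hy'1 : y' ∉ c.sq 1 := hfar y' fun i => (hy' i).trans (by norm_num)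
  have hy'e : y' + e τ' ∉ c.sq 1 := hfar _ fun i => by
    have h := abs_le.mp (hy' i)
    rw [Pi.add_apply, e_apply]
    split_ifs <;> (rw [abs_le]; constructor <;> linarith)
  by_cases hbt : BondTouches (cube (ℓ + 1) c.a c.M c.ρ c.k 0) y' τ'
  · exact eta_norm_le_of_touches c hη hQ0 hbt hy'1 hy'e
  · exact hout y' τ' (by rwa [c.sq_zero])

/-- **THE LEVEL SLACK OF A SIDE BOND**: a point within sup-distance one of `Ω′_j ⊂ □_j` lies in `□_{j−1} = Ω′_{j−1}` (collar `ρL^{j−1} ≥ 1`; `j − 1 < k`), so `j ≤ levD(y + t) + 1`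
(`j ≤ k`). [cite: Balaban1985RegularSpaces, (1.131) p.99, (1.5) p.77; Balaban1985Variational, (148)–(150) p.301; Balaban1984PropagatorsII, (2.3)–(2.4) p.224] -/
theorem le_levD_translate_add_one {Mh j : ℕ} (hjk : j ≤ c.k) {s y : Fin (d + 1) → ℤ} (hs : s ∈ c.sq j) (hy : ∀ i, |y i - s i| ≤ 1) :
    j ≤ levD Mh c (y + shift ℓ Mh c.a c.ρ c.k c.k) + 1 := by
  rcases Nat.lt_or_ge 1 j with hj2 | hj1
  · have hs' : s ∈ cube (ℓ + 1) c.a c.M c.ρ c.k j := c.sq_subset_cube hjk hs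
    have hyj : y ∈ cube (ℓ + 1) c.a c.M c.ρ c.k (j - 1) := by
      by_contra hy'
      obtain ⟨i, hi⟩ := collar_gap c.a (show j - 1 < c.k by omega) hy' (show s ∈ cube (ℓ + 1) c.a c.M c.ρ c.k (j - 1 + 1) by
        rw [Nat.sub_add_cancel (by omega)]; exact hs')
      have h1 : 1 ≤ c.ρ * (ℓ + 1) ^ (j - 1) := Nat.mul_pos (by have := c.L_le_ρ; omega) (Nat.pow_pos (Nat.succ_pos ℓ))
      have h1z : (1 : ℤ) ≤ (c.ρ : ℤ) * (((ℓ + 1 : ℕ) : ℤ)) ^ (j - 1) := by exact_mod_cast h1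
      linarith [hy i]
    have hysq : y ∈ c.sq (j - 1) := by rw [c.sq_of_lt (by omega)]; exact hyj
    have h := (le_levD_iff Mh c (show 1 ≤ j - 1 by omega) (show j - 1 ≤ c.k by omega) (y + shift ℓ Mh c.a c.ρ c.k c.k)).2
      (by rw [add_sub_cancel_right]; exact hysq)
    omega
  · omega

end FieldSide

/-! ## §2 Torus-side: the two size lines of the reading at `D = cubeTDomainsDented …` -/

section TorusSide

variable {ℓ mV KV : ℕ} {hd : 1 ≤ d + 1} {hL : Odd (ℓ + 1) ∧ 1 < ℓ + 1}

section Member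

variable {Mh K : ℕ} {Ω : ℕ → Set (Fin (d + 1) → ℤ)} (hℓ : 1 ≤ ℓ) (hMh : 2 ≤ Mh) (c : CubeB8D (d + 1) (ℓ + 1) K Ω) {R : ℕ}
  (hρ : Mh * (ℓ + 1) ∣ c.ρ) (hM : Mh * (ℓ + 1) ∣ c.M) (hR : R * (Mh * (ℓ + 1)) ≤ c.ρ)
  {P : Fin (d + 1) → ℕ} (hfit : ∀ μ, boxP ℓ c.M c.ρ c.k c.k μ ≤ P μ)
  (hΩ : ∀ y y' : Fin (d + 1) → ℤ, blk (bigSide ℓ Mh c.k) y' = blk (bigSide ℓ Mh c.k) y →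
    (y - shift ℓ Mh c.a c.ρ c.k c.k ∈ Ω c.k ↔ y' - shift ℓ Mh c.a c.ρ c.k c.k ∈ Ω c.k))
  (hN : ∀ μ, N0 ℓ Mh c.k P μ = (PV d ℓ mV KV hd hL).sitesPerDir 0) (hk : c.k ≤ mV + KV)

/-- ★★ **THE `J` SIZE LINE OF THE READING AT THE DENTED MEMBER, `nJ := (16(d+1)+1)·N`**: `(L^{lev}η)³|J(φ)(labels b − t)| ≤ nJ` with `lev = levD`: at a bond touching `Ω′_{lev}`
this is hypothesis (i); otherwise `lev = 0`, the bond is off `□₀`, and the local bound (`J` is a double difference over the stencil, every stencil bond carrying `η|φ| ≤ N`) gives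
`η³|J| ≤ 16(d+1)N`. [cite: Balaban1985RegularSpaces, (1.59) p.86, (1.55) p.86, (1.131) p.99; Balaban1985Variational, (148)–(152) p.301; Balaban1984PropagatorsII, (2.136) p.247] -/
theorem abs_dcsE_dcE_liftB_le {η : ℝ} (hη : 0 < η) {φ : (Fin (d + 1) → ℤ) → Fin (d + 1) → ℂ} {N : ℝ} (hN0 : 0 ≤ N) (hρ3 : 3 ≤ c.ρ)
    (hJ : ∀ j ≤ c.k, ∀ y τ, BondTouches (c.sq j) y τ →
      (((ℓ : ℝ) + 1) ^ j * η) ^ 3 * ‖Jcur η (1 : (Fin (d + 1) → ℤ) → Fin (d + 1) → ℂˣ) φ τ y‖ ≤ N)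
    (hQ0 : ∀ b ∈ c.lamBP 0, ‖linCovIter (ℓ + 1) (1 : (Fin (d + 1) → ℤ) → Fin (d + 1) → ℂˣ) (iEta η φ) 0 b.1 b.2‖ ≤ N)
    (hout : ∀ y τ, ¬ BondTouches (c.sq 0) y τ → η * ‖φ y τ‖ ≤ N)
    (hψ2 : DeepSupp ((PV d ℓ mV KV hd hL).sitesPerDir 0) 2 (fun w => φ (w - shift ℓ Mh c.a c.ρ c.k c.k)))
    (h2N : (2 : ℤ) ≤ ((PV d ℓ mV KV hd hL).sitesPerDir 0 : ℕ)) (g : ℂ →ₗ[ℝ] ℝ) (hg : ∀ z, |g z| ≤ ‖z‖)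
    (b : PBond (PV d ℓ mV KV hd hL) 0) :
    |(dcsE η⁻¹ (dcE η⁻¹ (WithLp.toLp 2 (liftB (hd := hd) (hL := hL) (mV := mV) (KV := KV) (ℓ := ℓ) g
        (fun w => φ (w - shift ℓ Mh c.a c.ρ c.k c.k)))))) b| ≤
      ((16 * ((d : ℝ) + 1) + 1) * N) *
        (((B6Geom246MultiLevelTorusL0.geomT (cubeTDomainsDented hℓ hMh c hρ hM hR P hfit hΩ)).len
            (blkV1 hN (cubeTDomainsDented hℓ hMh c hρ hM hR P hfit hΩ) b) * |η⁻¹|⁻¹) ^ 3)⁻¹ := by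
  have hk1 := c.one_le_k
  have hcfinv : |η⁻¹|⁻¹ = η := by rw [abs_of_pos (inv_pos.2 hη), inv_inv]
  rw [dcsE_dcE_liftB (le_refl (2 : ℤ)) h2N g hψ2, Jcur_one_translate, len_blkV1_member, hcfinv]
  set x := labels b.src - shift ℓ Mh c.a c.ρ c.k c.k with hx
  set lv := levD Mh c (labels b.src) with hlv
  have hlvn : lv ≤ c.k := levD_labels_le c _
  have hwpos : 0 < (((ℓ : ℝ) + 1) ^ lv * η) ^ 3 := by positivity
  have hNle : N ≤ (16 * ((d : ℝ) + 1) + 1) * N := by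
    have : (0 : ℝ) ≤ d := Nat.cast_nonneg _
    nlinarith
  rw [← div_eq_mul_inv, le_div_iff₀ hwpos]
  by_cases htouch : BondTouches (c.sq lv) x b.dir
  · have h := hJ lv hlvn x b.dir htouch
    calc |g (Jcur η 1 φ b.dir x)| * ((((ℓ : ℝ) + 1) ^ lv * η) ^ 3)
        ≤ ‖Jcur η 1 φ b.dir x‖ * ((((ℓ : ℝ) + 1) ^ lv * η) ^ 3) := mul_le_mul_of_nonneg_right (hg _) hwpos.le
      _ ≤ N := by linarith [h]
      _ ≤ (16 * ((d : ℝ) + 1) + 1) * N := hNle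
  · -- `lv = 0` and the bond is off `□₀`
    have hlv0 : lv = 0 := by
      by_contra hne
      have hlv1 : 1 ≤ lv := Nat.one_le_iff_ne_zero.mpr hne
      have hxin : x ∈ c.sq lv := (le_levD_labels_iff c hlv1 hlvn b.src).1 le_rfl
      exact htouch (Or.inl hxin)
    have hx0 : x ∉ cube (ℓ + 1) c.a c.M c.ρ c.k 0 := fun h => htouch (Or.inl (by rw [hlv0, c.sq_zero]; exact h))
    have hnear : ∀ (y' : Fin (d + 1) → ℤ) (τ' : Fin (d + 1)), (∀ i, |y' i - x i| ≤ 1) → ‖φ y' τ'‖ ≤ N * η⁻¹ := by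
      intro y' τ' hy'
      have h := eta_norm_le_of_near_not_mem c hη.le hρ3 hQ0 hout hx0 hy' τ'
      rw [← div_eq_mul_inv, le_div_iff₀ hη, mul_comm]; exact h
    have hloc := norm_Jcur_one_le_of_near hη (by positivity : 0 ≤ N * η⁻¹) hnear b.dir
    rw [hlv0, pow_zero, one_mul]
    calc |g (Jcur η 1 φ b.dir x)| * η ^ 3 ≤ ‖Jcur η 1 φ b.dir x‖ * η ^ 3 := mul_le_mul_of_nonneg_right (hg _) (by positivity)
      _ ≤ (16 * ((d : ℝ) + 1) * N * (η ^ 3)⁻¹) * η ^ 3 := mul_le_mul_of_nonneg_right (hloc.trans_eq (by ring)) (by positivity)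
      _ = 16 * ((d : ℝ) + 1) * N := by rw [mul_assoc, inv_mul_cancel₀ (pow_ne_zero 3 hη.ne'), mul_one]
      _ ≤ (16 * ((d : ℝ) + 1) + 1) * N := by nlinarith [hN0]

/-- ★★ **THE `B` SIZE LINE OF THE READING AT THE DENTED MEMBER, `nB := N`**: `(Lʲη)|Q_jA(b)| ≤ N` on every index bond `b ∈ Λ′_j`: for `j ≥ 1` by the currency lemma
(`(Lʲη)|Q_j(g∘ψ)| ≤ |Q_j(iηψ)|` of [B7] Prop. 4) and the class dictionary `𝔅 ↔ c.lamBP j` (hypothesis (ii)); for `j = 0` the index bond has both ends off `t + Ω′₁` and `Q₀ = 1`,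
so hypothesis (ii) at level `0` (if it touches `□₀`) or (iii) applies. [cite: Balaban1985RegularSpaces, (1.59) p.86, (1.131) p.99; Balaban1985Variational, (148)–(152) p.301; Balaban1984PropagatorsII, (2.3) p.224, (2.20) p.226; Balaban1985Averaging, Prop. 4 p.38] -/
theorem abs_QE_liftB_le {η : ℝ} (hη : 0 < η) {φ : (Fin (d + 1) → ℤ) → Fin (d + 1) → ℂ} {N : ℝ}
    (hQ : ∀ j ≤ c.k, ∀ b ∈ c.lamBP j, ‖linCovIter (ℓ + 1) (1 : (Fin (d + 1) → ℤ) → Fin (d + 1) → ℂˣ) (iEta η φ) j b.1 b.2‖ ≤ N)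
    (hout : ∀ y τ, ¬ BondTouches (c.sq 0) y τ → η * ‖φ y τ‖ ≤ N)
    {r : ℤ} (hrn : (((ℓ + 1) ^ c.k : ℕ) : ℤ) ≤ r) (hrN : r ≤ ((PV d ℓ mV KV hd hL).sitesPerDir 0 : ℕ))
    (hψ : DeepSupp ((PV d ℓ mV KV hd hL).sitesPerDir 0) r (fun w => φ (w - shift ℓ Mh c.a c.ρ c.k c.k)))
    {Mφ : ℝ} (hMφ0 : 0 ≤ Mφ) (hMφ : ∀ z τ, ‖φ z τ‖ ≤ Mφ) (g : ℂ →ₗ[ℝ] ℝ) (hg : ∀ z, |g z| ≤ ‖z‖)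
    (i : B6SectAOperatorsV1.BondIdx (domT hN (cubeTDomainsDented hℓ hMh c hρ hM hR P hfit hΩ) hk)) :
    |(QE (domT hN (cubeTDomainsDented hℓ hMh c hρ hM hR P hfit hΩ) hk)
        (WithLp.toLp 2 (liftB (hd := hd) (hL := hL) (mV := mV) (KV := KV) (ℓ := ℓ) g (fun w => φ (w - shift ℓ Mh c.a c.ρ c.k c.k))))) i| ≤
      N * ((((ℓ : ℝ) + 1) ^ (i.1.1 : ℕ) * |η⁻¹|⁻¹))⁻¹ := by
  have hL1 : 1 ≤ ℓ + 1 := Nat.succ_pos ℓ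
  have hρ0 : 0 < c.ρ := lt_of_lt_of_le (Nat.succ_pos ℓ) c.L_le_ρ
  have h1k : 0 < c.k := c.one_le_k
  have hcfinv : |η⁻¹|⁻¹ = η := by rw [abs_of_pos (inv_pos.2 hη), inv_inv]
  have hMψ : ∀ w ν, ‖(fun w => φ (w - shift ℓ Mh c.a c.ρ c.k c.k)) w ν‖ ≤ Mφ := fun w ν => hMφ _ ν
  obtain ⟨⟨⟨jv, hjv⟩, b⟩, hLam⟩ := i
  have hjn : jv ≤ c.k := Nat.lt_succ_iff.mp hjv
  rw [QE_apply, hcfinv]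
  show |bondAvgIter jv (liftB (hd := hd) (hL := hL) (mV := mV) (KV := KV) (ℓ := ℓ) g (fun w => φ (w - shift ℓ Mh c.a c.ρ c.k c.k))) b| ≤
    N * ((((ℓ : ℝ) + 1) ^ jv * η))⁻¹
  have hwpos : 0 < ((ℓ : ℝ) + 1) ^ jv * η := by positivity
  rw [← div_eq_mul_inv, le_div_iff₀ hwpos]
  rcases Nat.eq_zero_or_pos jv with hj0 | hjpos
  · -- level `0`: `Q₀ = 1`, the index bond has both ends off `t + Ω′₁`
    subst hj0
    rw [B5Eq120IterProof.bondAvgIter_zero, liftB_apply, pow_zero, one_mul]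
    obtain ⟨hsrc, htgt⟩ := (lamBond_zero_iff hℓ hMh c hρ hM hR hfit hΩ hN hk b).1 hLam
    set x := labels b.src - shift ℓ Mh c.a c.ρ c.k c.k with hx
    show |g (φ x b.dir)| * η ≤ N
    have hgx : |g (φ x b.dir)| * η ≤ η * ‖φ x b.dir‖ := by rw [mul_comm]; exact mul_le_mul_of_nonneg_left (hg _) hη.le
    refine hgx.trans ?_
    by_cases hbt : BondTouches (cube (ℓ + 1) c.a c.M c.ρ c.k 0) x b.dir
    · -- touching `□₀`: the source label is deep, so the target label is the source label `+ e_dir` (no wrap-around)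
      have h2ρ : (2 : ℤ) ≤ ((c.ρ * (ℓ + 1) ^ c.k : ℕ) : ℤ) := by
        have : 2 ≤ c.ρ * (ℓ + 1) ^ c.k := le_trans (by have := c.L_le_ρ; omega : 2 ≤ c.ρ) (Nat.le_mul_of_pos_right _ (Nat.pow_pos hL1))
        exact_mod_cast this
      have hdeepx : labels b.src b.dir + 1 < ((PV d ℓ mV KV hd hL).sitesPerDir 0 : ℕ) := by
        rcases hbt with h | h
        · have hdp := B8CubeMemberTorusDomainsL0.siteDeep_shift_of_mem_cube_zero hℓ hMh c.a c.one_le_k le_rfl hfit h b.dir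
          rw [hN, hx, sub_add_cancel] at hdp
          linarith [hdp.2]
        · have hdp := B8CubeMemberTorusDomainsL0.siteDeep_shift_of_mem_cube_zero hℓ hMh c.a c.one_le_k le_rfl hfit h b.dir
          rw [hN, hx] at hdp
          simp only [Pi.add_apply, Pi.sub_apply, e_apply, ite_true] at hdp
          linarith [hdp.2]
      have hsrcbox : labels b.tgt = labels b.src + e b.dir := by
        have h := labelsJ_shift_of_lt (j := 0) b.src b.dir (by rw [labelsJ_zero]; exact hdeepx)
        rw [labelsJ_zero, labelsJ_zero] at h
        exact h
      have htgt' : x + e b.dir ∉ c.sq 1 := by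
        have h : labels b.tgt - shift ℓ Mh c.a c.ρ c.k c.k = x + e b.dir := by rw [hsrcbox, hx]; abel
        rw [← h]; exact htgt
      exact eta_norm_le_of_touches c hη.le (hQ 0 (Nat.zero_le _)) hbt hsrc htgt'
    · exact hout x b.dir (by rwa [c.sq_zero])
  · -- level `jv ≥ 1`: the currency lemma and the class dictionary
    have hjf : jv ≤ mV + KV := hjn.trans hk
    have hrj : (((ℓ + 1) ^ jv : ℕ) : ℤ) ≤ r := le_trans (by exact_mod_cast Nat.pow_le_pow_right hL1 hjn) hrn
    have hcur := norm_bondAvgIter_liftB_le hjf hrj hrN g hg hψ hMφ0 hMψ hη b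
    have htr := linCovIter_one_translate (ℓ := ℓ) (j := jv) φ hMφ0 hMφ hη.le (shiftJ ℓ Mh c.a c.ρ c.k c.k jv) (labelsJ b.src) b.dir
    have hψeq : (fun w ν => φ (w - (((ℓ + 1) ^ jv : ℕ) : ℤ) • shiftJ ℓ Mh c.a c.ρ c.k c.k jv) ν) = fun w => φ (w - shift ℓ Mh c.a c.ρ c.k c.k) := by
      funext w ν; rw [shift_eq_smul_shiftJ ℓ Mh c.a hjn le_rfl]
    rw [hψeq] at htr
    rw [htr] at hcur
    have htgt := labelsJ_tgt_of_lamBond hℓ hMh c hρ hM hR hfit hΩ hN hk hjpos hjn hLam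
    have hmem := (lamBond_iff hℓ hMh c hρ hM hR hfit hΩ hN hk hjpos hjn b htgt).1 hLam
    have h := hQ jv hjn _ hmem
    calc |bondAvgIter jv (liftB g (fun w => φ (w - shift ℓ Mh c.a c.ρ c.k c.k))) b| * (((ℓ : ℝ) + 1) ^ jv * η)
        = ((((ℓ + 1 : ℕ) : ℝ)) ^ jv * η) * |bondAvgIter jv (liftB g (fun w => φ (w - shift ℓ Mh c.a c.ρ c.k c.k))) b| := by push_cast; ring
      _ ≤ ‖linCovIter (ℓ + 1) 1 (iEta η φ) jv (labelsJ b.src - shiftJ ℓ Mh c.a c.ρ c.k c.k jv) b.dir‖ := hcur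
      _ ≤ N := h

end Member

end TorusSide

end Literature.MathematicalPhysics.QuantumFieldTheory.Balaban1983to89.B8DentedCubeMemberTorusSizeLines
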